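import Summits.AtomisticToContinuum.Crystallization.Theorems.ChargedEnergyGapTwinReduce

/-!
(SPLIT FOR THE 400-LINE CAP by the landing lane, hand-2 g29: this file = part A; part B = `…ChargedEnergyGapTwinSector` imports it; same namespace, all FQNs unchanged.)
# `ChargedEnergyGap` — TWIN SECTORS: parity, face normals, the two-pair lemma and JUNCTION EXCLUSION around a line
# (cell `decomp-a2c`, lens 3, generation 58, node «JunctionExclusion», part P-F; over P-E(3/3) `…Theorems.ChargedEnergyGapTwinReduce`;
# SUPPORT beneath (N𝄪) `LocalSeamReductionW` of part P-D `…Theorems.ChargedEnergyGapLocalTransfer`)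

WHAT P-E LEFT (memo g57 §0.3, critic row 1081 (4)): the edge lemma, the closure criterion and the tree theorem are proved, but the
step of (N𝄪)'s architecture that USES them — (E1) «around a line in gross-free weighted matter the coherent faces pair into complete
planes» (memo g56 §2.1, g57 §2) — was prose, and its physical inputs were a LIST of five local configurations the census was asked to
certify gross at `θ = 3/20` (GROSS-56: terminating tips, junction / intersection lines, Σ9 contacts, fivefold axes, cell vertices).  The
critic's instruction for g58: type the pairing step «so that its hypotheses are exactly what GROSS-56 is asked to certify … and nothing
metric beyond ϱ, ϱχ».

THIS FILE (0 sorry; no `def … : Prop`, no instance, no axiom, no dial; record and residual of record byte-unchanged):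
 §0 CLOSED WORDS.  `prod_map_twinRot_eq_one_of_mem` (an integral product of twin operations IS the identity: no non-trivial cubic
    symmetry is reachable by coherent twinning), `prod_map_twinRot_append_mem_comm` / `prod_map_twinRot_rotate_mem` (closure of a face
    word is invariant under cyclic rotation — the loop may start in any grain), `length_twinReduce_mod_two`, ★ `even_length_of_prod_mem`
    (a closed face word has EVEN length: no tips `k = 1`, no triple junctions `k = 3`, NO FIVEFOLD AXES `k = 5` — for every choice of systems).
 §1 THE SECTOR DICTIONARY, part 1 (reference-frame bookkeeping).  For a face word `w = a₀ a₁ ⋯ a_{k−1}` read around a line `e`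
    (face `j` separates grain `G_j` from `G_{j+1}`, `G_0 = G_k` the reference grain; letter `a_j` = the {111} system of face `j` in the
    frame of `G_j`; frame of `G_j` = `R_{a₀} ⋯ R_{a_{j−1}}`), the NORMAL of face `j` in reference coordinates is the rational vector
    `faceNormal w j = R_{a₀}⋯R_{a_{j−1}} · axis(a_j)` (denominator `3^j`).  Lemmas: prefix / shift / deletion transport
    (`faceNormal_append_left`, `faceNormal_length_add`, `faceNormal_delete`), ★ `faceNormal_eq_succ_of_getElem_eq` (a backtracking pair
    `a_j = a_{j+1}` has EQUAL normals: `R_a` fixes its own axis), and ★★ the TWO-PAIR LEMMA `exists_two_pairs_of_prod_mem`: a CLOSED word of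
    length `≥ 3` has a consecutive pair of faces with equal normals AND, disjoint from it, a second pair of faces with equal normals (edge
    lemma, peel the lamella — `prod_map_twinRot_append_cons_cons` — edge lemma again, transport back).
 §2 THE SECTOR DICTIONARY, part 2 (the two incidence axioms) and ★★★ JUNCTION EXCLUSION `length_eq_two_of_sector` /
    `sector_structure`: let the faces be half-planes issuing from the line `e`, face `j` pointing in the direction `u j` (a vector of
    any real inner-product space — the plane `e^⊥`); assume (COPLANAR) two distinct faces with the same reference normal are OPPOSITE
    half-planes (`u j = −u i`: both lie in parallel crystallographic planes containing `e`, hence in one plane) and (CONSECUTIVE) if two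
    consecutive faces `i, i+1` are opposite half-planes then every other face lies in ONE open half-space (`0 < ⟪m, u l⟫`: the grain
    between them is a flat half-space, the word lists the faces in angular order).  THEN a closed word has length EXACTLY `2`, it is `[a, a]`,
    and `u 1 = −u 0`: the line lies in the interior of ONE complete coherent plane of ONE system — it is not a tip, a bend, a junction of
    `≥ 3` faces, a crossing, a fivefold axis; in particular complete planes in gross-free matter never meet, so cell vertices do not occur
    either.  (Proof: the two pairs of §1; the consecutive pair confines all other faces to an open half-space, where two opposite
    half-planes cannot both lie.)
 §3 CONTROLS: odd words (`k = 1, 3, 5`) never close; `abab` does not close (Σ9 crossing); `abba` closes ALGEBRAICALLY (`twinReduce = []`)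
    yet has the two pairs `(1,2)`, `(0,3)` with equal normals, so NO sector realisation exists — the geometric layer is not idle;
    NON-VACUITY `sector_axioms_pair`: the complete plane `[a, a]` with faces `x, −x` satisfies all three hypotheses.
 §4 THE ANGULAR MODEL (the incidence axioms are plane geometry, not assumptions about matter): faces at angles
    `θ 0 < θ 1 < ⋯ < θ (k−1) < θ 0 + 2π` in `e^⊥ = span(e₁, e₂)` (orthonormal), `u j = cos (θ j) • e₁ + sin (θ j) • e₂`.  THEN (CONSECUTIVE)
    is a THEOREM (`consecutive_of_angular`: opposite consecutive faces differ by `π` — `angle_eq_add_pi_of_dir_eq_neg` — and every other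
    face lies in the open half-space `0 < ⟪sin (θ i) • e₁ − cos (θ i) • e₂, ·⟫`, by `sin > 0` on `(0, π)`), distinct faces have distinct
    directions (`dir_ne_of_lt`), and (COPLANAR) weakens to (COLLINEAR) «faces with equal reference normal are collinear, `u j = ± u i`».
    ★★★ `length_eq_two_of_angular` / `sector_structure_of_angular`: ANGULAR ORDER + (COLLINEAR) + (CLOSED) ⇒ `k = 2`, `w = [a, a]`,
    `θ 1 = θ 0 + π`.  Non-vacuity `angular_axioms_pair` (angles `0, π`).

HOW THIS SHRINKS THE PHYSICAL INPUT OF (N𝄪) (the residual's census list).  Of the five GROSS-56 configurations, those built from COHERENT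
faces alone — tips, bends, coherent triple / multiple junctions, crossings, fivefold stars (as exact coherent arrangements), and hence
vertices of twin cells — are now EXCLUDED BY THEOREM in the sector model; what the census / a species-side lemma must still supply is only
(INCOH) «a wall that is NOT a coherent {111} Σ3 face (Σ9 and higher contacts, {112} incoherent segments, the partial-dislocation line
ending a lamella) and the strained core of a closure defect (the 7.35° wedge disclination of a fivefold star) are UNCHARTED at `θ = 3/20`»,
i.e. gross, so that `w = 0` within `ϱ/2` of them — ONE class instead of five, and the class the lineage's CORED convention already prices.
The modelling step «θ-charted Barlow matter near a line ⟹ a sector configuration» is reduced by §4 to: the faces at `e` are half-planes at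
distinct angles (ANGULAR ORDER — what "the faces around a line" means), each coherent face lies in the crystallographic plane through `e`
with its reference normal (COLLINEAR — the definition of a coherent {111} face, transported by the frames of §1), and the walk around `e`
returns to the starting grain (CLOSED); plus the chart-to-coherence input (INCOH) that every wall met IS such a face.  Nothing metric beyond
`ϱ, ϱχ` enters; no numeral enters at all (`π` only through `Real.sin`/`Real.cos`).

TAGS.  §0–§2, §4: SUPPORT · PROVED, beneath (N𝄪) `LocalSeamReductionW` [WEAKER than (Nˢ); UNDECIDED · ATTACKABLE-L]; (H𝄪) `LocalSeamTransferBoundC`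
[STRONGER than (Hˢ); UNDECIDED · INSTRUMENTABLE ← χCOST-56] untouched; record `(ϱχ, Cχ) = (80, 10⁻⁵)`, `(μ₀,τ,λ,b₀,r_S,C_T) = (1/100, 3/100, 1/2, 2/5, 3,
1/(3·10⁶))`, `ϱ = 160` unchanged; residual of record: χCOST-56 (unchanged) and GROSS-56 ↦ (INCOH) (sharpened).  WHY THIS IS NOVEL: the
metallurgical junction rules (Σ3·Σ3 = Σ9 needs a third wall; fivefold twins leave a 7.35° gap; a coherent twin cannot end) are folklore
case by case, and the free-group bookkeeping of Σ3ⁿ strings (Reed–Minich–Rudd–Kumar 2004, Cayron 2007: letters `a b c d`, equal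
consecutive letters cancel, the empty string is the identity) is used there to IDENTIFY Σ3ⁿ misorientations; here ONE kernel-checked
statement — closed coherent face word + angular order + collinearity ⇒ exactly two opposite faces — covers every junction case at once, by
the 3-adic edge lemma (P-E) applied twice, deletion transport of face normals, and a half-space argument, and converts a five-item census
ask into one ((INCOH)).
-/

open Matrix
open scoped RealInnerProductSpace

namespace Summit.AtomisticToContinuum.Crystallization.Theorems.ChargedEnergyGapChartDial

section TwinSector

/-! ### §0 Closed words: the product is the identity, cyclic invariance, parity -/

/-- ★ A CLOSED face word composes to the IDENTITY: if the product of the twin operations along a word is an integral matrix (a lattice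
symmetry) then it is `1` — no non-trivial cubic symmetry is reachable by coherent Σ3 twinning. -/
theorem prod_map_twinRot_eq_one_of_mem {w : List (Fin 4)} (h : (w.map twinRot).prod ∈ integralMatrices) :
    (w.map twinRot).prod = 1 := by
  rw [← prod_map_twinRot_twinReduce, (prod_map_twinRot_mem_iff_twinReduce_eq_nil w).1 h, List.map_nil, List.prod_nil]

/-- Closure criterion, identity form: integral ⟺ equal to `1`. -/
theorem prod_map_twinRot_mem_iff_eq_one (w : List (Fin 4)) :
    (w.map twinRot).prod ∈ integralMatrices ↔ (w.map twinRot).prod = 1 :=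
  ⟨prod_map_twinRot_eq_one_of_mem, fun h => h ▸ one_mem_integralMatrices⟩

/-- CYCLIC INVARIANCE: a loop around a line may be started in any grain — `l₁ ++ l₂` closes iff `l₂ ++ l₁` does. -/
theorem prod_map_twinRot_append_mem_comm {l₁ l₂ : List (Fin 4)} (h : ((l₁ ++ l₂).map twinRot).prod ∈ integralMatrices) :
    ((l₂ ++ l₁).map twinRot).prod ∈ integralMatrices := by
  have h1 := prod_map_twinRot_eq_one_of_mem h
  rw [List.map_append, List.prod_append] at h1 ⊢
  rw [mul_eq_one_comm.1 h1]
  exact one_mem_integralMatrices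

/-- … in `List.rotate` form. -/
theorem prod_map_twinRot_rotate_mem {w : List (Fin 4)} (n : ℕ) (h : (w.map twinRot).prod ∈ integralMatrices) :
    ((w.rotate n).map twinRot).prod ∈ integralMatrices := by
  rw [List.rotate_eq_drop_append_take_mod]
  apply prod_map_twinRot_append_mem_comm
  rwa [List.take_append_drop]

/-- One push changes the stack length by exactly one. -/
theorem length_twinPush_mod_two (a : Fin 4) (r : List (Fin 4)) : (twinPush a r).length % 2 = (r.length + 1) % 2 := by
  cases r with
  | nil => simp [twinPush]
  | cons b r =>
    by_cases hab : a = b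
    · rw [twinPush, if_pos hab, List.length_cons]; omega
    · rw [twinPush, if_neg hab]; simp only [List.length_cons]

/-- Free reduction preserves the PARITY of the length. -/
theorem length_twinReduce_mod_two (w : List (Fin 4)) : (twinReduce w).length % 2 = w.length % 2 := by
  induction w with
  | nil => rfl
  | cons a w ih => rw [twinReduce, length_twinPush_mod_two, List.length_cons]; omega

/-- ★ PARITY: a closed face word has EVEN length — around a line in defect-free coherently twinned matter an even number of faces meet.
No terminating tip (`k = 1`), no triple junction (`k = 3`), no FIVEFOLD AXIS (`k = 5`), whatever the systems. -/
theorem even_length_of_prod_mem {w : List (Fin 4)} (h : (w.map twinRot).prod ∈ integralMatrices) : Even w.length := by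
  have h0 := length_twinReduce_mod_two w
  rw [(prod_map_twinRot_mem_iff_twinReduce_eq_nil w).1 h, List.length_nil, Nat.zero_mod] at h0
  exact Nat.even_iff.2 h0.symm

/-- Contrapositive: a face word of ODD length never closes. -/
theorem prod_map_twinRot_not_mem_of_odd {w : List (Fin 4)} (h : Odd w.length) : (w.map twinRot).prod ∉ integralMatrices :=
  fun hI => (Nat.not_even_iff_odd.2 h) (even_length_of_prod_mem hI)

/-- Deleting one twin lamella `… a a …` does not change the product (hence not the closure) of a face word. -/
theorem prod_map_twinRot_append_cons_cons (l₁ l₂ : List (Fin 4)) (a : Fin 4) :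
    ((l₁ ++ a :: a :: l₂).map twinRot).prod = ((l₁ ++ l₂).map twinRot).prod := by
  simp only [List.map_append, List.map_cons, List.prod_append, List.prod_cons]
  rw [← mul_assoc (twinRot a), twinRot_mul_self, one_mul]

/-! ### §1 The sector dictionary, part 1: frames and face normals in reference coordinates; the two-pair lemma -/

/-- The `⟨111⟩` axis of system `a` as a rational vector. -/
def twinAxisℚ (a : Fin 4) : Fin 3 → ℚ := fun i => (twinAxis a i : ℚ)

/-- `R_a` fixes its own axis (rational-vector form of `twinRot_mulVec_axis`). -/
theorem twinRot_mulVec_twinAxisℚ (a : Fin 4) : twinRot a *ᵥ twinAxisℚ a = twinAxisℚ a :=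
  twinRot_mulVec_axis a

/-- The FACE NORMAL of face `j` of the face word `w`, in the coordinates of the reference grain `G_0`: the frame of the grain `G_j` being
left, `R_{a₀} ⋯ R_{a_{j−1}}`, applied to the axis of the letter `a_j` (for `j ≥ w.length` a junk value, never used). -/
def faceNormal (w : List (Fin 4)) (j : ℕ) : Fin 3 → ℚ :=
  ((w.take j).map twinRot).prod *ᵥ twinAxisℚ (w.getD j 0)

/-- Face `0` (read in the reference frame) has normal `axis(a₀)`. -/
theorem faceNormal_cons_zero (a : Fin 4) (l : List (Fin 4)) : faceNormal (a :: l) 0 = twinAxisℚ a := by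
  simp [faceNormal]

/-- Face `1` has normal `R_{a₀}·axis(a₁)`. -/
theorem faceNormal_cons_one (b c : Fin 4) (l : List (Fin 4)) : faceNormal (b :: c :: l) 1 = twinRot b *ᵥ twinAxisℚ c := by
  simp [faceNormal]

/-- PREFIX: the normals of the faces before position `l₁.length` do not depend on the rest of the word. -/
theorem faceNormal_append_left {l₁ l₂ : List (Fin 4)} {i : ℕ} (hi : i < l₁.length) :
    faceNormal (l₁ ++ l₂) i = faceNormal l₁ i := by
  unfold faceNormal
  rw [List.take_append_of_le_length hi.le, List.getD_eq_getElem?_getD, List.getD_eq_getElem?_getD,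
    List.getElem?_append_left hi]

/-- SHIFT: the normal of face `l₁.length + i` of `l₁ ++ l₂` is the frame `R(l₁)` applied to the normal of face `i` of `l₂`. -/
theorem faceNormal_length_add (l₁ l₂ : List (Fin 4)) (i : ℕ) :
    faceNormal (l₁ ++ l₂) (l₁.length + i) = (l₁.map twinRot).prod *ᵥ faceNormal l₂ i := by
  unfold faceNormal
  rw [List.take_length_add_append, List.map_append, List.prod_append, ← Matrix.mulVec_mulVec,
    List.getD_eq_getElem?_getD, List.getD_eq_getElem?_getD, List.getElem?_append_right (Nat.le_add_right _ _),
    Nat.add_sub_cancel_left]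

/-- The face right after the prefix `l₁` has normal `R(l₁)·axis(a)`. -/
theorem faceNormal_append_cons (l₁ l₂ : List (Fin 4)) (a : Fin 4) :
    faceNormal (l₁ ++ a :: l₂) l₁.length = (l₁.map twinRot).prod *ᵥ twinAxisℚ a := by
  have h := faceNormal_length_add l₁ (a :: l₂) 0
  rw [Nat.add_zero, faceNormal_cons_zero] at h
  exact h

/-- ★ A BACKTRACKING PAIR HAS EQUAL NORMALS: in `l₁ a a l₂` the two faces lettered `a` — the two walls of one twin lamella, read in the
frames of the two grains they are left from — have the SAME normal in reference coordinates (`R_a` fixes `axis(a)`). -/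
theorem faceNormal_append_cons_cons_succ (l₁ l₂ : List (Fin 4)) (a : Fin 4) :
    faceNormal (l₁ ++ a :: a :: l₂) (l₁.length + 1) = faceNormal (l₁ ++ a :: a :: l₂) l₁.length := by
  have h := faceNormal_length_add l₁ (a :: a :: l₂) 1
  rw [faceNormal_cons_one, twinRot_mulVec_twinAxisℚ, ← faceNormal_append_cons l₁ (a :: l₂) a] at h
  exact h

/-- Two faces later than a deleted lamella: `faceNormal (a a l) (i + 2) = faceNormal l i` (`R_a R_a = 1`). -/
theorem faceNormal_cons_cons_add_two (a : Fin 4) (l : List (Fin 4)) (i : ℕ) :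
    faceNormal (a :: a :: l) (i + 2) = faceNormal l i := by
  have h := faceNormal_length_add [a, a] l i
  rw [show [a, a].length + i = i + 2 by simp only [List.length_cons, List.length_nil]; omega] at h
  simpa [twinRot_mul_self] using h

/-- Index form of a backtracking pair: `w = l₁ ++ a :: a :: l₂` with `l₁.length = i`. -/
theorem exists_eq_append_cons_cons_of_getElem_eq {w : List (Fin 4)} {i : ℕ} (hi : i + 1 < w.length)
    (h : w[i] = w[i + 1]) : ∃ (l₁ l₂ : List (Fin 4)) (a : Fin 4), w = l₁ ++ a :: a :: l₂ ∧ l₁.length = i := by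
  refine ⟨w.take i, w.drop (i + 2), w[i + 1], ?_, ?_⟩
  · calc w = w.take i ++ w.drop i := (List.take_append_drop i w).symm
      _ = w.take i ++ (w[i] :: w[i + 1] :: w.drop (i + 2)) := by
          rw [List.drop_eq_getElem_cons (Nat.lt_of_succ_lt hi), List.drop_eq_getElem_cons hi]
      _ = w.take i ++ (w[i + 1] :: w[i + 1] :: w.drop (i + 2)) := by rw [h]
  · rw [List.length_take]; omega

/-- ★ Index form of the equal-normal lemma: `a_i = a_{i+1}` ⇒ faces `i` and `i+1` have the same normal. -/
theorem faceNormal_eq_succ_of_getElem_eq {w : List (Fin 4)} {i : ℕ} (hi : i + 1 < w.length) (h : w[i] = w[i + 1]) :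
    faceNormal w i = faceNormal w (i + 1) := by
  obtain ⟨l₁, l₂, a, rfl, rfl⟩ := exists_eq_append_cons_cons_of_getElem_eq hi h
  rw [faceNormal_append_cons_cons_succ]

/-- DELETION TRANSPORT: removing the lamella `a a` after the prefix `l₁` renumbers the later faces by `+2` and changes NO normal
(`R_a R_a = 1` between them). -/
theorem faceNormal_delete (l₁ l₂ : List (Fin 4)) (a : Fin 4) (x : ℕ) :
    faceNormal (l₁ ++ l₂) x = faceNormal (l₁ ++ a :: a :: l₂) (if x < l₁.length then x else x + 2) := by
  split_ifs with hx
  · rw [faceNormal_append_left hx, faceNormal_append_left hx]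
  · obtain ⟨i, rfl⟩ := Nat.exists_eq_add_of_le (not_lt.1 hx)
    rw [faceNormal_length_add, Nat.add_assoc, faceNormal_length_add, faceNormal_cons_cons_add_two]

/-- ★★ THE TWO-PAIR LEMMA.  A CLOSED face word of length `≥ 3` has (i) a CONSECUTIVE pair of faces `p, p+1` with equal reference normals
and (ii) a second pair of faces `r < s`, disjoint from `{p, p+1}`, with equal reference normals.  (Edge lemma ⇒ (i); delete the lamella,
the word still closes, edge lemma again, transport the indices back ⇒ (ii).) -/
theorem exists_two_pairs_of_prod_mem {w : List (Fin 4)} (h3 : 3 ≤ w.length) (hI : (w.map twinRot).prod ∈ integralMatrices) :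
    ∃ p : ℕ, p + 1 < w.length ∧ faceNormal w p = faceNormal w (p + 1) ∧
      ∃ r s : ℕ, r < s ∧ s < w.length ∧ r ≠ p ∧ r ≠ p + 1 ∧ s ≠ p ∧ s ≠ p + 1 ∧ faceNormal w r = faceNormal w s := by
  have hw : w ≠ [] := by rintro rfl; simp at h3
  obtain ⟨p, hp, hpp⟩ := exists_adjacent_eq_of_prod_mem hw hI
  refine ⟨p, hp, faceNormal_eq_succ_of_getElem_eq hp hpp, ?_⟩
  obtain ⟨l₁, l₂, a, hwl, hl⟩ := exists_eq_append_cons_cons_of_getElem_eq hp hpp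
  have hlen : (l₁ ++ l₂).length + 2 = w.length := by
    rw [hwl]; simp only [List.length_append, List.length_cons]; omega
  have hI' : ((l₁ ++ l₂).map twinRot).prod ∈ integralMatrices := by rwa [← prod_map_twinRot_append_cons_cons, ← hwl]
  have hw' : l₁ ++ l₂ ≠ [] := by
    intro h0; rw [h0, List.length_nil] at hlen; omega
  obtain ⟨j, hj, hjj⟩ := exists_adjacent_eq_of_prod_mem hw' hI'
  have hN := faceNormal_eq_succ_of_getElem_eq hj hjj
  rw [faceNormal_delete l₁ l₂ a j, faceNormal_delete l₁ l₂ a (j + 1), ← hwl] at hN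
  refine ⟨if j < l₁.length then j else j + 2, if j + 1 < l₁.length then j + 1 else j + 1 + 2, ?_, ?_, ?_, ?_, ?_, ?_, hN⟩ <;>
    split_ifs <;> omega

/-! ### §2 The sector dictionary, part 2 (two incidence axioms) and JUNCTION EXCLUSION -/

variable {V : Type*} [NormedAddCommGroup V] [InnerProductSpace ℝ V]

/-- ★★★ JUNCTION EXCLUSION.  Faces around a line `e`: face `j` is a half-plane issuing from `e` in the direction `u j ∈ e^⊥` and carries
the letter `a_j` of the face word `w` (its {111} system in the frame of the grain being left).  Assume
 (COPLANAR)    two distinct faces with the same reference normal are OPPOSITE half-planes, `u j = −u i` (both lie in crystallographic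
               planes with that normal containing `e`, i.e. in one plane through `e`);
 (CONSECUTIVE) if two consecutive faces `i, i+1` are opposite half-planes, all other faces lie in ONE open half-space: some `m` with
               `0 < ⟪m, u l⟫` for every other `l` (the grain between them is a flat half-space; the word is read in angular order);
 (CLOSED)      the orientation returns: the product of the twin operations along `w` is a lattice symmetry (integral).
THEN exactly TWO faces meet at `e`.  No tip, no bend, no junction of `≥ 3` coherent faces, no crossing, no fivefold axis. -/
theorem length_eq_two_of_sector {w : List (Fin 4)} (hw : w ≠ []) (u : ℕ → V)
    (hcopl : ∀ i j : ℕ, i < w.length → j < w.length → i ≠ j → faceNormal w i = faceNormal w j → u j = -u i)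
    (hcons : ∀ i : ℕ, i + 1 < w.length → u (i + 1) = -u i →
      ∃ m : V, ∀ l : ℕ, l < w.length → l ≠ i → l ≠ i + 1 → 0 < ⟪m, u l⟫)
    (hI : (w.map twinRot).prod ∈ integralMatrices) : w.length = 2 := by
  obtain ⟨p₀, hp₀, -⟩ := exists_adjacent_eq_of_prod_mem hw hI
  by_contra h2
  have h3 : 3 ≤ w.length := by omega
  obtain ⟨p, hp, hNp, r, s, hrs, hs, hrp, hrp', hsp, hsp', hNrs⟩ := exists_two_pairs_of_prod_mem h3 hI
  have hup : u (p + 1) = -u p := hcopl p (p + 1) (Nat.lt_of_succ_lt hp) hp (by omega) hNp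
  obtain ⟨m, hm⟩ := hcons p hp hup
  have hus : u s = -u r := hcopl r s (lt_trans hrs hs) hs (ne_of_lt hrs) hNrs
  have h₁ := hm r (lt_trans hrs hs) hrp hrp'
  have h₂ := hm s hs hsp hsp'
  rw [hus, inner_neg_right] at h₂
  linarith

/-- ★★★ SECTOR STRUCTURE: under the same hypotheses the word is `[a, a]` for one system `a` and the two faces are opposite half-planes —
the line lies in the INTERIOR of ONE COMPLETE COHERENT PLANE of one system (it is not an edge of anything). -/
theorem sector_structure {w : List (Fin 4)} (hw : w ≠ []) (u : ℕ → V)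
    (hcopl : ∀ i j : ℕ, i < w.length → j < w.length → i ≠ j → faceNormal w i = faceNormal w j → u j = -u i)
    (hcons : ∀ i : ℕ, i + 1 < w.length → u (i + 1) = -u i →
      ∃ m : V, ∀ l : ℕ, l < w.length → l ≠ i → l ≠ i + 1 → 0 < ⟪m, u l⟫)
    (hI : (w.map twinRot).prod ∈ integralMatrices) : ∃ a : Fin 4, w = [a, a] ∧ u 1 = -u 0 := by
  have h2 := length_eq_two_of_sector hw u hcopl hcons hI
  obtain ⟨i, hi, hii⟩ := exists_adjacent_eq_of_prod_mem hw hI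
  have hi0 : i = 0 := by omega
  subst hi0
  have hu : u 1 = -u 0 := hcopl 0 1 (by omega) (by omega) zero_ne_one (faceNormal_eq_succ_of_getElem_eq hi hii)
  obtain ⟨x, y, rfl⟩ := List.length_eq_two.1 h2
  have hxy : x = y := by simpa using hii
  exact ⟨x, by rw [hxy], hu⟩

omit [InnerProductSpace ℝ V] in
/-- The purely algebraic shadow used by (N𝄪)'s bookkeeping: under (COPLANAR) alone, a closed word of length `≥ 3` already exhibits two
DISJOINT pairs of opposite half-planes among the faces at `e` (two complete planes through `e`) — what (CONSECUTIVE) then forbids. -/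
theorem two_opposite_pairs_of_prod_mem {w : List (Fin 4)} (h3 : 3 ≤ w.length) (u : ℕ → V)
    (hcopl : ∀ i j : ℕ, i < w.length → j < w.length → i ≠ j → faceNormal w i = faceNormal w j → u j = -u i)
    (hI : (w.map twinRot).prod ∈ integralMatrices) :
    ∃ p r s : ℕ, p + 1 < w.length ∧ r < s ∧ s < w.length ∧ r ≠ p ∧ r ≠ p + 1 ∧ s ≠ p ∧ s ≠ p + 1 ∧
      u (p + 1) = -u p ∧ u s = -u r := by
  obtain ⟨p, hp, hNp, r, s, hrs, hs, hrp, hrp', hsp, hsp', hNrs⟩ := exists_two_pairs_of_prod_mem h3 hI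
  exact ⟨p, r, s, hp, hrs, hs, hrp, hrp', hsp, hsp', hcopl p (p + 1) (Nat.lt_of_succ_lt hp) hp (by omega) hNp,
    hcopl r s (lt_trans hrs hs) hs (ne_of_lt hrs) hNrs⟩

/-! ### §3 Controls -/

/-- A single coherent face cannot be the only face at a line (no terminating tip) — parity form of `twinRot_not_mem`. -/
theorem not_closed_one (a : Fin 4) : ([a].map twinRot).prod ∉ integralMatrices :=
  prod_map_twinRot_not_mem_of_odd ⟨0, rfl⟩

/-- No three coherent faces meet along a line, whatever their systems (the Σ3·Σ3 = Σ9 rule: the third wall is not a Σ3 face). -/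
theorem not_closed_three (a b c : Fin 4) : ([a, b, c].map twinRot).prod ∉ integralMatrices :=
  prod_map_twinRot_not_mem_of_odd ⟨1, rfl⟩

/-- No FIVEFOLD axis of coherent faces closes, for ANY five systems (not only the cyclic `ababa` star of P-E's control). -/
theorem not_closed_five (a b c d f : Fin 4) : ([a, b, c, d, f].map twinRot).prod ∉ integralMatrices :=
  prod_map_twinRot_not_mem_of_odd ⟨2, rfl⟩

/-- Two coherent planes of different systems cannot CROSS along a line with all four sectors coherent: `abab` does not close. -/
theorem not_closed_abab {a b : Fin 4} (hab : a ≠ b) : ([a, b, a, b].map twinRot).prod ∉ integralMatrices :=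
  prod_map_twinRot_not_mem (by simp)
    (List.isChain_cons_cons.2 ⟨hab, List.isChain_cons_cons.2 ⟨Ne.symm hab, List.isChain_cons_cons.2 ⟨hab, List.isChain_singleton b⟩⟩⟩)

/-- `abba` DOES close algebraically (a lamella inside a lamella) … -/
theorem closed_abba (a b : Fin 4) : ([a, b, b, a].map twinRot).prod ∈ integralMatrices := by
  rw [show [a, b, b, a] = [a] ++ b :: b :: [a] from rfl, prod_map_twinRot_append_cons_cons,
    show [a] ++ [a] = [] ++ a :: a :: [] from rfl, prod_map_twinRot_append_cons_cons]
  simpa using one_mem_integralMatrices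

/-- … and its faces `1, 2` and `0, 3` have pairwise equal normals (two complete planes through the line), so by `length_eq_two_of_sector`
it admits NO sector realisation: the word problem alone does not exclude it, the two incidence axioms do. -/
theorem abba_normals (a b : Fin 4) :
    faceNormal [a, b, b, a] 1 = faceNormal [a, b, b, a] 2 ∧ faceNormal [a, b, b, a] 0 = faceNormal [a, b, b, a] 3 := by
  constructor
  · exact (faceNormal_append_cons_cons_succ [a] [a] b).symm
  · have h0 : faceNormal [a, b, b, a] 0 = faceNormal [a, a] 0 := by simpa using (faceNormal_delete [a] [a] b 0).symm
    have h3 : faceNormal [a, b, b, a] 3 = faceNormal [a, a] 1 := by simpa using (faceNormal_delete [a] [a] b 1).symm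
    rw [h0, h3]
    simpa using (faceNormal_append_cons_cons_succ [] [] a).symm

/-- NON-VACUITY of the three hypotheses of `length_eq_two_of_sector`: ONE complete coherent plane — the word `[a, a]` with opposite
faces `x, -x` — satisfies (COPLANAR), (CONSECUTIVE) and (CLOSED) (so the conclusion `length = 2` is attained, not vacuous). -/
theorem sector_axioms_pair (a : Fin 4) (x : V) :
    ([a, a] : List (Fin 4)) ≠ [] ∧
    (∀ i j : ℕ, i < [a, a].length → j < [a, a].length → i ≠ j → faceNormal [a, a] i = faceNormal [a, a] j →
      (fun n : ℕ => if n = 0 then x else -x) j = -(fun n : ℕ => if n = 0 then x else -x) i) ∧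
    (∀ i : ℕ, i + 1 < [a, a].length → (fun n : ℕ => if n = 0 then x else -x) (i + 1) = -(fun n : ℕ => if n = 0 then x else -x) i →
      ∃ m : V, ∀ l : ℕ, l < [a, a].length → l ≠ i → l ≠ i + 1 → 0 < ⟪m, (fun n : ℕ => if n = 0 then x else -x) l⟫) ∧
    (([a, a] : List (Fin 4)).map twinRot).prod ∈ integralMatrices := by
  refine ⟨List.cons_ne_nil a [a], ?_, ?_, ?_⟩
  · intro i j hi hj hij _
    simp only [List.length_cons, List.length_nil] at hi hj
    rcases Nat.lt_or_gt_of_ne hij with h | h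
    · have hi0 : i = 0 := by omega
      have hj1 : j = 1 := by omega
      subst hi0 hj1; simp
    · have hj0 : j = 0 := by omega
      have hi1 : i = 1 := by omega
      subst hj0 hi1; simp
  · intro i hi _
    simp only [List.length_cons, List.length_nil] at hi
    exact ⟨0, fun l hl hli hli1 => absurd hl (by simp only [List.length_cons, List.length_nil]; omega)⟩
  · rw [List.map_cons, List.map_cons, List.map_nil, List.prod_cons, List.prod_cons, List.prod_nil, mul_one, twinRot_mul_self]
    exact one_mem_integralMatrices

end TwinSector

end Summit.AtomisticToContinuum.Crystallization.Theorems.ChargedEnergyGapChartDial
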